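import Summits.QuantumFields.BalabanUV.Beta.GAN24.StepDifferenceThreeWindows
import Summits.QuantumFields.BalabanUV.Beta.GAN24.MixedStepLinearity

/-!
# `BalabanUV.Beta.GAN24.StepDifferenceInterpolation` — binder row G-an2-4 ∕ (CONV-C), W-slot, the (α-0) parity re-cut, located crux (Q-L-k₀), the DRIFT rows
# (leaf-03 g68 FILE 4 `HΔw`): **THE DRIFT WINDOW FROM FOUR NATURAL WINDOWS OF RE-ROOTED FAMILIES, BY CUBIC INTERPOLATION — NO MIXED CARRIER.**

NOT IN PRINT; OUR BOOKKEEPING ([folklore] polynomial interpolation + linearity bookkeeping on leaf-03's `Lin4LegTowerUnroll` (`legStepB`, `legChain`, `bsumPow`,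
the bounded class), the OWNER gan24-p1 g37's part 9 `MixedSlotCarrier` (`legStep₃`) and part 10 `StepDifferenceThreeWindows` (bounded class, additivity of the
window map), and MY `MixedStepLinearity` (homogeneity ∕ additivity of `legStep₃` in each kernel, re-rooting); 0 `def`, 0 cited facts, 0 `def … : Prop`, 0 sorry).
HONEST FRAMING (cell contract, verbatim): «discharging `BetaPertH` makes Bałaban's UV stability UNCONDITIONAL — a real constructive-QFT result; it is NOT the
continuum limit and NOT the Clay problem.»  HONEST DEPENDENCY (verbatim): «continuum YM on T⁴ ⇐ BetaPertH ∧ nine spine estimates (0/9 proved); BetaPertH ⇐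
(D1) ∧ (D4) ∧ CAP+tail; G-an2-4 gates asym, D1 and NE2/3/4.»

THE POINT (generic `d`; a kernel family `K` with every level decaying, `kc (l+1) = kc l`, a BOUNDED table `W`; `Λ X := legChain kc K N (l+2) q (bsumPow N q ∘ X)`,
`𝔹W := fun s ↦ bsum N (W s)`).  The binder `HΔw` of leaf-03's (Q-L) END consumes only the object `Λ(legStepB kc K N (l+1) W − legStepB kc K N l W)`, and
`D(M) := Λ(legStep (kc l) M M N 𝔹W)` is a CUBIC FORM in the kernel `M` (two slot legs through `vsym M = vsym₂ M M`, one kernel leg through `comp M`; `Λ` is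
linear on the bounded class).  Writing `K (l+1) = K l + s • Δ` with `0 ≤ s ≤ 1` (the consumer takes `s := c_K·θ^l ∕ C` and `Δ := s⁻¹ • (K♮_{l+1} − K♮_l)`, so
that `Δ` decays with the natural kernels' constant — THE NORMALISATION THAT ISOLATES `θ^l` ON DIAGONAL OBJECTS), `t ↦ D(K l + t • Δ)` is a polynomial of degree
`≤ 3` (entrywise), so LAGRANGE INTERPOLATION at the nodes `t = 0, 1, 2, 3` is exact:
`D(K (l+1)) − D(K l) = Σ_{j=0}^{3} (L_j(s) − [j = 0]) • D(K l + j • Δ)`, with `|L₀(s) − 1| + |L₁(s)| + |L₂(s)| + |L₃(s)| ≤ 20s∕3 ≤ 7s` on `[0,1]`.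
* §1 the bounded class under `+`, `•`; `Λ(X − Y) = ΛX − ΛY`;
* §2 **`legStep_line_expand`**, **`window_line_expand`** — the cubic expansion of `t ↦ D(A + t • B)`;
* §3 `lagrange_cubic_sub`, `lagrange_weights_le`;
* §4 **`locStencil₂_stepDiff_of_interpolation`**: `(∀ j ≤ 3, LocStencil₂ (Λ(legStep (kc l) (K l + j•Δ) (K l + j•Δ) N 𝔹W)) c δ′)
     ⟹ LocStencil₂ (legChain kc K N (l+2) q (fun s′ ↦ bsumPow N q ((legStepB kc K N (l+1) W − legStepB kc K N l W) s′))) (7·s·c) δ′` — VERBATIM the OWNER's part 10 ∕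
  leaf-03 FILE 4's `HΔw` object — and **`locStencil₂_stepDiff_of_rerooted_windows`**: the same conclusion from FOUR NATURAL `(q+1)`-WINDOWS
  `legChain kc (update K (l+1) (K l + j•Δ)) N (l+1) (q+1) (bsumPow N (q+1) ∘ W)`, `j ≤ 3` — the H1-window shape, whose composite legs are the OWNER's 8a ∕ 8b objects
  (`kChain (krow ∘ update K (l+1) M) (l+1) q`, `Push4Iter.legChain (colH ∘ update K (l+1) M) (l+1) q`), `Mⱼ = K l + j•Δ` decaying with constant `C + j·C_Δ`, uniformly in `l`.
  **`exists_normalised_step`** + **`locStencil₂_stepDiff_of_decaying_step`**: the consumer-facing form — hypotheses `Decays (K (l+1) − K l) ε δ_Δ`, `0 ≤ ε ≤ C_Δ`,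
  `0 < C_Δ`, and the four windows FOR EVERY `Δ` with `Decays Δ C_Δ δ_Δ`; conclusion `LocStencil₂ · (7·(ε∕C_Δ)·c) δ′` (linear in `ε = c_K·θ^l`).
CONSEQUENCE: no mixed carrier (`vertex2W₂ ∕ legPush₂`), no mixed nesting law, no second three-leg core are needed for (H1Δw); part 10's three-window identity stays true
but off the critical path.  Asserts NOTHING about Bałaban's tables; NOT (H1Δw) (the four windows and their letters are the OWNER's ∕ leaf-03's END); NOTHING of
(Q-L) ∕ (H1♮) ∕ (C)sym discharged; NEVER «G-an2-4 closed» as (CONV-C); NOT D1, NOT `BetaPertH`, NOT continuum, NOT Clay; not in print.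
Unit `b2b-balaban-gan24-formalise-leaf-01` (G-an2-4 formalisation swarm, leaf prover 01), gen 75, 2026-08-23.
-/

noncomputable section

open Finset
open scoped BigOperators
open Literature.MathematicalPhysics.QuantumFieldTheory
open Literature.MathematicalPhysics.QuantumFieldTheory.Balaban1983to89
open Literature.MathematicalPhysics.QuantumFieldTheory.Balaban1983to89.Beta
open B12Sec2to5 (l1 l1_nonneg)
open ExpKernelCalculus (MKer Site Decays BiLoc comp)
open OneStepResolventKernel (Fib)
open Summit.QuantumFields.BalabanUV.Beta.GAN24.Lin4LegTower (bsum legStep)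
open Summit.QuantumFields.BalabanUV.Beta.GAN24.Lin4LegTowerTwo (bdd_bsum)
open Summit.QuantumFields.BalabanUV.Beta.GAN24.Lin4LegTowerUnroll (legStepB bsumPow legChain bddTab_legStepB)
open Summit.QuantumFields.BalabanUV.Beta.GAN24.MixedSlotCarrier (legStep₃ legStep₃_self)
open Summit.QuantumFields.BalabanUV.Beta.GAN24.StepDifferenceThreeWindows (nonneg_of_decays bdd_legStep₃ legChain_bsumPow_add)
open Summit.QuantumFields.BalabanUV.Beta.GAN24.MixedStepLinearity
open Summit.QuantumFields.BalabanUV.Beta.GAN24.BiStencilZeroMode (Tab)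

namespace Summit.QuantumFields.BalabanUV.Beta.GAN24.StepDifferenceInterpolation

variable {d : ℕ}

/-! ## §1 The bounded class under `+`, `•`; the window map is subtractive -/

section Window

variable {kc : ℕ → ℝ} {Kf : ℕ → MKer (d + 1) (Fib d)} {N : ℕ}

/-- [folklore] A bounded table stays bounded under a scalar. -/
theorem bddTab_smul (c : ℝ) {X : Tab d} (hX : ∃ B : ℝ, ∀ κ u κ' u' x z a b, |X κ u κ' u' x z a b| ≤ B) :
    ∃ B : ℝ, ∀ κ u κ' u' x z a b, |(c • X) κ u κ' u' x z a b| ≤ B := by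
  obtain ⟨B, hB⟩ := hX
  refine ⟨|c| * B, fun κ u κ' u' x z a b => ?_⟩
  show |c * X κ u κ' u' x z a b| ≤ |c| * B
  rw [abs_mul]
  exact mul_le_mul_of_nonneg_left (hB κ u κ' u' x z a b) (abs_nonneg c)

/-- [folklore] A sum of bounded tables is bounded. -/
theorem bddTab_add {X Y : Tab d} (hX : ∃ B : ℝ, ∀ κ u κ' u' x z a b, |X κ u κ' u' x z a b| ≤ B)
    (hY : ∃ B : ℝ, ∀ κ u κ' u' x z a b, |Y κ u κ' u' x z a b| ≤ B) :
    ∃ B : ℝ, ∀ κ u κ' u' x z a b, |(X + Y) κ u κ' u' x z a b| ≤ B := by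
  obtain ⟨BX, hBX⟩ := hX
  obtain ⟨BY, hBY⟩ := hY
  exact ⟨BX + BY, fun κ u κ' u' x z a b => (abs_add_le _ _).trans (add_le_add (hBX κ u κ' u' x z a b) (hBY κ u κ' u' x z a b))⟩

/-- [folklore] The window map `X ↦ legChain kc K N m k (bsumPow N q ∘ X)` is SUBTRACTIVE on the bounded class (part 10's additivity ⨾ homogeneity at `−1`). -/
theorem legChain_bsumPow_sub (hK : ∀ n, ∃ δ C : ℝ, 0 < δ ∧ Decays (Kf n) C δ) (m k q : ℕ) {X Y : Tab d}
    (hX : ∃ B : ℝ, ∀ κ u κ' u' x z a b, |X κ u κ' u' x z a b| ≤ B) (hY : ∃ B : ℝ, ∀ κ u κ' u' x z a b, |Y κ u κ' u' x z a b| ≤ B) :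
    legChain kc Kf N m k (fun κ u κ' u' => bsumPow N q ((X - Y) κ u κ' u'))
      = legChain kc Kf N m k (fun κ u κ' u' => bsumPow N q (X κ u κ' u')) - legChain kc Kf N m k (fun κ u κ' u' => bsumPow N q (Y κ u κ' u')) := by
  rw [sub_eq_add_neg X Y, show -Y = (-1 : ℝ) • Y from (neg_one_smul ℝ Y).symm,
    legChain_bsumPow_add hK m k q hX (bddTab_smul (-1) hY), legChain_bsumPow_smul, neg_one_smul, ← sub_eq_add_neg]

end Window

/-! ## §2 The cubic expansion of `t ↦ D(A + t • B)` -/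

section Cubic

variable {A B : MKer (d + 1) (Fib d)} {CA δA CB δB Bw : ℝ} {N : ℕ}

/-- NOT IN PRINT; OUR BOOKKEEPING.  **THE ONE-STEP LEG MAP ALONG A LINE OF KERNELS IS A CUBIC**: for decaying `A`, `B` and a bounded table,
`legStep kc (A + t•B) (A + t•B) N W s = T₀ s + t•T₁ s + t²•T₂ s + t³•T₃ s` with `T₀ = legStep₃ kc A A A`, `T₁ = legStep₃ kc B A A + legStep₃ kc A B A + legStep₃ kc A A B`,
`T₂ = legStep₃ kc B B A + legStep₃ kc B A B + legStep₃ kc A B B`, `T₃ = legStep₃ kc B B B` (trilinearity of part 9's mixed step in its kernels). -/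
theorem legStep_line_expand (hA : Decays A CA δA) (hδA : 0 < δA) (hB : Decays B CB δB) (hδB : 0 < δB) (kc t : ℝ)
    {W : Tab d} (hW : ∀ κ u κ' u' x z a b, |W κ u κ' u' x z a b| ≤ Bw)
    (κ : Fin (d + 1)) (u : Fin (d + 1) → ℤ) (κ' : Fin (d + 1)) (u' : Fin (d + 1) → ℤ) :
    legStep kc (A + t • B) (A + t • B) N W κ u κ' u'
      = legStep₃ kc A A A N W κ u κ' u'
        + t • (legStep₃ kc B A A N W κ u κ' u' + legStep₃ kc A B A N W κ u κ' u' + legStep₃ kc A A B N W κ u κ' u')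
        + t ^ 2 • (legStep₃ kc B B A N W κ u κ' u' + legStep₃ kc B A B N W κ u κ' u' + legStep₃ kc A B B N W κ u κ' u')
        + t ^ 3 • legStep₃ kc B B B N W κ u κ' u' := by
  have hCA := nonneg_of_decays hA
  have hCB := nonneg_of_decays hB
  have htB : Decays (t • B) (|t| * CB) δB := decays_smul_of t hB
  have htC : 0 ≤ |t| * CB := mul_nonneg (abs_nonneg t) hCB
  have hM : Decays (A + t • B) (CA + |t| * CB) (min δA δB) := decays_add_min' hA htB hCA htC
  have hδM : 0 < min δA δB := lt_min hδA hδB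
  have hCM : 0 ≤ CA + |t| * CB := add_nonneg hCA htC
  rw [← legStep₃_self,
    -- kernel leg
    legStep₃_add_kernel (N := N) hM hδM hM hδM hA hδA htB hδB kc hW, legStep₃_smul_kernel,
    -- second slot
    legStep₃_add_snd (N := N) hM hδM hCM hA hδA htB hδB hA hδA kc hW, legStep₃_smul_snd,
    legStep₃_add_snd (N := N) hM hδM hCM hA hδA htB hδB hB hδB kc hW, legStep₃_smul_snd,
    -- first slot
    legStep₃_add_fst (N := N) hA hδA htB hδB hA hδA hA hδA kc hW, legStep₃_smul_fst,
    legStep₃_add_fst (N := N) hA hδA htB hδB hB hδB hA hδA kc hW, legStep₃_smul_fst,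
    legStep₃_add_fst (N := N) hA hδA htB hδB hA hδA hB hδB kc hW, legStep₃_smul_fst,
    legStep₃_add_fst (N := N) hA hδA htB hδB hB hδB hB hδB kc hW, legStep₃_smul_fst]
  funext x z a b
  simp only [Pi.add_apply, Pi.smul_apply, smul_eq_mul]
  ring

variable {kc : ℕ → ℝ} {Kf : ℕ → MKer (d + 1) (Fib d)}

/-- NOT IN PRINT; OUR BOOKKEEPING.  **THE WINDOW ALONG A LINE OF BOTTOM KERNELS IS A CUBIC**: with `Λ X := legChain kc K N m k (bsumPow N q ∘ X)` (every level of `K`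
decaying) and the tables `Tᵢ` of `legStep_line_expand`, `Λ(legStep c (A + t•B) (A + t•B) N W) = Λ T₀ + t • Λ T₁ + t² • Λ T₂ + t³ • Λ T₃`
(part 10's additivity on the bounded class + `MixedStepLinearity`'s homogeneity). -/
theorem window_line_expand (hK : ∀ n, ∃ δ C : ℝ, 0 < δ ∧ Decays (Kf n) C δ) (m k q : ℕ)
    (hA : Decays A CA δA) (hδA : 0 < δA) (hB : Decays B CB δB) (hδB : 0 < δB) (c t : ℝ)
    {W : Tab d} (hW : ∀ κ u κ' u' x z a b, |W κ u κ' u' x z a b| ≤ Bw) :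
    legChain kc Kf N m k (fun κ u κ' u' => bsumPow N q (legStep c (A + t • B) (A + t • B) N W κ u κ' u'))
      = legChain kc Kf N m k (fun κ u κ' u' => bsumPow N q (legStep₃ c A A A N W κ u κ' u'))
        + t • legChain kc Kf N m k (fun κ u κ' u' => bsumPow N q
            ((fun κ u κ' u' => legStep₃ c B A A N W κ u κ' u' + legStep₃ c A B A N W κ u κ' u' + legStep₃ c A A B N W κ u κ' u') κ u κ' u'))
        + t ^ 2 • legChain kc Kf N m k (fun κ u κ' u' => bsumPow N q
            ((fun κ u κ' u' => legStep₃ c B B A N W κ u κ' u' + legStep₃ c B A B N W κ u κ' u' + legStep₃ c A B B N W κ u κ' u') κ u κ' u'))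
        + t ^ 3 • legChain kc Kf N m k (fun κ u κ' u' => bsumPow N q (legStep₃ c B B B N W κ u κ' u')) := by
  -- boundedness of the eight mixed steps
  have hb : ∀ X Y Z : MKer (d + 1) (Fib d), (X = A ∨ X = B) → (Y = A ∨ Y = B) → (Z = A ∨ Z = B) →
      ∃ B' : ℝ, ∀ κ u κ' u' x z a b, |(fun κ u κ' u' => legStep₃ c X Y Z N W κ u κ' u') κ u κ' u' x z a b| ≤ B' := by
    have hdec : ∀ X : MKer (d + 1) (Fib d), (X = A ∨ X = B) → ∃ CX δX : ℝ, 0 < δX ∧ Decays X CX δX := by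
      rintro X (rfl | rfl)
      · exact ⟨CA, δA, hδA, hA⟩
      · exact ⟨CB, δB, hδB, hB⟩
    intro X Y Z hX hY hZ
    obtain ⟨CX, δX, hδX, hXd⟩ := hdec X hX
    obtain ⟨CY, δY, hδY, hYd⟩ := hdec Y hY
    obtain ⟨CZ, δZ, hδZ, hZd⟩ := hdec Z hZ
    exact ⟨_, fun κ u κ' u' x z a b => bdd_legStep₃ (N := N) hXd hδX hYd hδY hZd hδZ c hW κ u κ' u' x z a b⟩
  have hT₀ := hb A A A (Or.inl rfl) (Or.inl rfl) (Or.inl rfl)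
  have hT₃ := hb B B B (Or.inr rfl) (Or.inr rfl) (Or.inr rfl)
  have hT₁ : ∃ B' : ℝ, ∀ κ u κ' u' x z a b,
      |(fun κ u κ' u' => legStep₃ c B A A N W κ u κ' u' + legStep₃ c A B A N W κ u κ' u' + legStep₃ c A A B N W κ u κ' u') κ u κ' u' x z a b| ≤ B' :=
    bddTab_add (bddTab_add (hb B A A (Or.inr rfl) (Or.inl rfl) (Or.inl rfl)) (hb A B A (Or.inl rfl) (Or.inr rfl) (Or.inl rfl)))
      (hb A A B (Or.inl rfl) (Or.inl rfl) (Or.inr rfl))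
  have hT₂ : ∃ B' : ℝ, ∀ κ u κ' u' x z a b,
      |(fun κ u κ' u' => legStep₃ c B B A N W κ u κ' u' + legStep₃ c B A B N W κ u κ' u' + legStep₃ c A B B N W κ u κ' u') κ u κ' u' x z a b| ≤ B' :=
    bddTab_add (bddTab_add (hb B B A (Or.inr rfl) (Or.inr rfl) (Or.inl rfl)) (hb B A B (Or.inr rfl) (Or.inl rfl) (Or.inr rfl)))
      (hb A B B (Or.inl rfl) (Or.inr rfl) (Or.inr rfl))
  -- the step table along the line, as a combination of tables
  have e : (fun κ u κ' u' => legStep c (A + t • B) (A + t • B) N W κ u κ' u')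
      = (fun κ u κ' u' => legStep₃ c A A A N W κ u κ' u')
        + t • (fun κ u κ' u' => legStep₃ c B A A N W κ u κ' u' + legStep₃ c A B A N W κ u κ' u' + legStep₃ c A A B N W κ u κ' u')
        + t ^ 2 • (fun κ u κ' u' => legStep₃ c B B A N W κ u κ' u' + legStep₃ c B A B N W κ u κ' u' + legStep₃ c A B B N W κ u κ' u')
        + t ^ 3 • (fun κ u κ' u' => legStep₃ c B B B N W κ u κ' u') := by
    funext κ u κ' u'
    rw [legStep_line_expand (N := N) hA hδA hB hδB c t hW κ u κ' u']
    rfl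
  have e' : (fun κ u κ' u' => bsumPow N q (legStep c (A + t • B) (A + t • B) N W κ u κ' u'))
      = fun κ u κ' u' => bsumPow N q (((fun κ u κ' u' => legStep₃ c A A A N W κ u κ' u')
        + t • (fun κ u κ' u' => legStep₃ c B A A N W κ u κ' u' + legStep₃ c A B A N W κ u κ' u' + legStep₃ c A A B N W κ u κ' u')
        + t ^ 2 • (fun κ u κ' u' => legStep₃ c B B A N W κ u κ' u' + legStep₃ c B A B N W κ u κ' u' + legStep₃ c A B B N W κ u κ' u')
        + t ^ 3 • (fun κ u κ' u' => legStep₃ c B B B N W κ u κ' u')) κ u κ' u') := by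
    rw [← e]
  rw [e', legChain_bsumPow_add hK m k q (bddTab_add (bddTab_add hT₀ (bddTab_smul t hT₁)) (bddTab_smul (t ^ 2) hT₂)) (bddTab_smul (t ^ 3) hT₃),
    legChain_bsumPow_add hK m k q (bddTab_add hT₀ (bddTab_smul t hT₁)) (bddTab_smul (t ^ 2) hT₂),
    legChain_bsumPow_add hK m k q hT₀ (bddTab_smul t hT₁),
    legChain_bsumPow_smul, legChain_bsumPow_smul, legChain_bsumPow_smul]

end Cubic

/-! ## §3 Lagrange interpolation at the nodes `0, 1, 2, 3` -/

/-- [folklore] Lagrange interpolation of a cubic at the nodes `0,1,2,3`, difference form: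
`p(s) − p(0) = (L₀(s) − 1)·p(0) + L₁(s)·p(1) + L₂(s)·p(2) + L₃(s)·p(3)`. -/
theorem lagrange_cubic_sub (a₀ a₁ a₂ a₃ s : ℝ) :
    (a₀ + s * a₁ + s ^ 2 * a₂ + s ^ 3 * a₃) - (a₀ + 0 * a₁ + 0 ^ 2 * a₂ + 0 ^ 3 * a₃)
      = ((1 - s) * (2 - s) * (3 - s) / 6 - 1) * (a₀ + 0 * a₁ + 0 ^ 2 * a₂ + 0 ^ 3 * a₃)
        + (s * (2 - s) * (3 - s) / 2) * (a₀ + 1 * a₁ + 1 ^ 2 * a₂ + 1 ^ 3 * a₃)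
        + (-(s * (1 - s) * (3 - s) / 2)) * (a₀ + 2 * a₁ + 2 ^ 2 * a₂ + 2 ^ 3 * a₃)
        + (s * (1 - s) * (2 - s) / 6) * (a₀ + 3 * a₁ + 3 ^ 2 * a₂ + 3 ^ 3 * a₃) := by
  ring

/-- [folklore] The four interpolation weights on `[0,1]`: `|L₀(s) − 1| + |L₁(s)| + |L₂(s)| + |L₃(s)| ≤ 7s` (in fact `≤ 20s∕3`). -/
theorem lagrange_weights_le {s : ℝ} (hs0 : 0 ≤ s) (hs1 : s ≤ 1) :
    |(1 - s) * (2 - s) * (3 - s) / 6 - 1| + |s * (2 - s) * (3 - s) / 2| + |(-(s * (1 - s) * (3 - s) / 2))| + |s * (1 - s) * (2 - s) / 6|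
      ≤ 7 * s := by
  have h1s : 0 ≤ 1 - s := sub_nonneg.2 hs1
  have h2s : 0 ≤ 2 - s := by linarith
  have h3s : 0 ≤ 3 - s := by linarith
  have e0 : (1 - s) * (2 - s) * (3 - s) / 6 - 1 = -(s * (11 - 6 * s + s ^ 2) / 6) := by ring
  have hq : 0 ≤ 11 - 6 * s + s ^ 2 := by nlinarith
  have a0 : |(1 - s) * (2 - s) * (3 - s) / 6 - 1| = s * (11 - 6 * s + s ^ 2) / 6 := by
    rw [e0, abs_neg, abs_of_nonneg (by positivity)]
  have a1 : |s * (2 - s) * (3 - s) / 2| = s * (2 - s) * (3 - s) / 2 := abs_of_nonneg (by positivity)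
  have a2 : |(-(s * (1 - s) * (3 - s) / 2))| = s * (1 - s) * (3 - s) / 2 := by rw [abs_neg, abs_of_nonneg (by positivity)]
  have a3 : |s * (1 - s) * (2 - s) / 6| = s * (1 - s) * (2 - s) / 6 := abs_of_nonneg (by positivity)
  rw [a0, a1, a2, a3]
  nlinarith [mul_nonneg hs0 hs0, mul_nonneg (mul_nonneg hs0 hs0) hs0, mul_nonneg hs0 h1s]

/-! ## §4 The drift window -/

section Main

variable {kc : ℕ → ℝ} {Kf : ℕ → MKer (d + 1) (Fib d)} {N : ℕ}

/-- [folklore] A `LocStencil₂` bound weakens to a larger constant (same rate). -/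
theorem locStencil₂_of_le {X : Tab d} {C C' δ : ℝ} (h : BalabanCompositeJets.LocStencil₂ X C δ) (hC : C ≤ C') :
    BalabanCompositeJets.LocStencil₂ X C' δ :=
  fun κ u κ' u' => StepJetData.biLoc_weaken (h κ u κ' u') (mul_le_mul_of_nonneg_right hC (Real.exp_pos _).le) le_rfl

/-- NOT IN PRINT; OUR BOOKKEEPING.  **THE DRIFT WINDOW `HΔw` FROM FOUR DIAGONAL WINDOWS, BY CUBIC INTERPOLATION.**  Every level of `K` decaying, `kc (l+1) = kc l`,
`W` bounded, `Δ` decaying, `0 ≤ s ≤ 1`, `K (l+1) = K l + s • Δ`; `Λ X := legChain kc K N (l+2) q (bsumPow N q ∘ X)`, `𝔹W := fun s′ ↦ bsum N (W s′)`.  IF the four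
diagonal windows `Λ(legStep (kc l) Mⱼ Mⱼ N 𝔹W)`, `Mⱼ := K l + j • Δ` (`j = 0,1,2,3`), obey `LocStencil₂ · c δ′`, THEN the `HΔw` object
`legChain kc K N (l+2) q (fun s′ ↦ bsumPow N q ((legStepB kc K N (l+1) W − legStepB kc K N l W) s′))` obeys `LocStencil₂ · (7·s·c) δ′`. -/
theorem locStencil₂_stepDiff_of_interpolation (hK : ∀ n, ∃ δ C : ℝ, 0 < δ ∧ Decays (Kf n) C δ) {l : ℕ} (hkc : kc (l + 1) = kc l) (q : ℕ)
    {W : Tab d} (hW : ∃ B : ℝ, ∀ κ u κ' u' x z a b, |W κ u κ' u' x z a b| ≤ B)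
    {Δ : MKer (d + 1) (Fib d)} {CΔ δΔ : ℝ} (hΔ : Decays Δ CΔ δΔ) (hδΔ : 0 < δΔ)
    {s : ℝ} (hs0 : 0 ≤ s) (hs1 : s ≤ 1) (hstep : Kf (l + 1) = Kf l + s • Δ) {c δ' : ℝ}
    (h : ∀ j : ℕ, j ≤ 3 → BalabanCompositeJets.LocStencil₂
      (legChain kc Kf N (l + 2) q (fun κ u κ' u' => bsumPow N q
        (legStep (kc l) (Kf l + (j : ℝ) • Δ) (Kf l + (j : ℝ) • Δ) N (fun κ u κ' u' => bsum N (W κ u κ' u')) κ u κ' u'))) c δ') :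
    BalabanCompositeJets.LocStencil₂
      (legChain kc Kf N (l + 2) q (fun κ u κ' u' => bsumPow N q ((legStepB kc Kf N (l + 1) W - legStepB kc Kf N l W) κ u κ' u')))
      (7 * s * c) δ' := by
  obtain ⟨δ₀, C₀, hδ₀, hK₀⟩ := hK l
  obtain ⟨Bw, hBw⟩ := hW
  have hc : 0 ≤ c := (h 0 (by norm_num)).nonneg
  -- the block-summed table is bounded
  have hBW : ∀ κ u κ' u' x z a b, |(fun κ u κ' u' => bsum N (W κ u κ' u')) κ u κ' u' x z a b| ≤ ((N : ℝ) ^ (d + 1)) * Bw :=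
    fun κ u κ' u' x z a b => bdd_bsum N (fun x z a b => hBw κ u κ' u' x z a b) x z a b
  -- names for the four coefficient windows `Λ Tᵢ`
  set Q₀ := legChain kc Kf N (l + 2) q (fun κ u κ' u' => bsumPow N q
    (legStep₃ (kc l) (Kf l) (Kf l) (Kf l) N (fun κ u κ' u' => bsum N (W κ u κ' u')) κ u κ' u')) with hQ₀
  set Q₁ := legChain kc Kf N (l + 2) q (fun κ u κ' u' => bsumPow N q
    ((fun κ u κ' u' => legStep₃ (kc l) Δ (Kf l) (Kf l) N (fun κ u κ' u' => bsum N (W κ u κ' u')) κ u κ' u'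
      + legStep₃ (kc l) (Kf l) Δ (Kf l) N (fun κ u κ' u' => bsum N (W κ u κ' u')) κ u κ' u'
      + legStep₃ (kc l) (Kf l) (Kf l) Δ N (fun κ u κ' u' => bsum N (W κ u κ' u')) κ u κ' u') κ u κ' u')) with hQ₁
  set Q₂ := legChain kc Kf N (l + 2) q (fun κ u κ' u' => bsumPow N q
    ((fun κ u κ' u' => legStep₃ (kc l) Δ Δ (Kf l) N (fun κ u κ' u' => bsum N (W κ u κ' u')) κ u κ' u'
      + legStep₃ (kc l) Δ (Kf l) Δ N (fun κ u κ' u' => bsum N (W κ u κ' u')) κ u κ' u'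
      + legStep₃ (kc l) (Kf l) Δ Δ N (fun κ u κ' u' => bsum N (W κ u κ' u')) κ u κ' u') κ u κ' u')) with hQ₂
  set Q₃ := legChain kc Kf N (l + 2) q (fun κ u κ' u' => bsumPow N q
    (legStep₃ (kc l) Δ Δ Δ N (fun κ u κ' u' => bsum N (W κ u κ' u')) κ u κ' u')) with hQ₃
  -- the window along the line `t ↦ K l + t • Δ`
  have hline : ∀ t : ℝ, legChain kc Kf N (l + 2) q (fun κ u κ' u' => bsumPow N q
      (legStep (kc l) (Kf l + t • Δ) (Kf l + t • Δ) N (fun κ u κ' u' => bsum N (W κ u κ' u')) κ u κ' u'))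
        = Q₀ + t • Q₁ + t ^ 2 • Q₂ + t ^ 3 • Q₃ := fun t =>
    window_line_expand hK (l + 2) q q hK₀ hδ₀ hΔ hδΔ (kc l) t hBW
  -- the `HΔw` object is `P(s) − P(0)`
  have hX : ∃ B : ℝ, ∀ κ u κ' u' x z a b, |legStepB kc Kf N (l + 1) W κ u κ' u' x z a b| ≤ B := bddTab_legStepB hK (l + 1) ⟨Bw, hBw⟩
  have hY : ∃ B : ℝ, ∀ κ u κ' u' x z a b, |legStepB kc Kf N l W κ u κ' u' x z a b| ≤ B := bddTab_legStepB hK l ⟨Bw, hBw⟩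
  have eX : legStepB kc Kf N (l + 1) W = fun κ u κ' u' =>
      legStep (kc l) (Kf l + s • Δ) (Kf l + s • Δ) N (fun κ u κ' u' => bsum N (W κ u κ' u')) κ u κ' u' := by
    funext κ u κ' u'
    show legStep (kc (l + 1)) (Kf (l + 1)) (Kf (l + 1)) N (fun κ u κ' u' => bsum N (W κ u κ' u')) κ u κ' u' = _
    rw [hkc, hstep]
  have eY : legStepB kc Kf N l W = fun κ u κ' u' =>
      legStep (kc l) (Kf l + (0 : ℝ) • Δ) (Kf l + (0 : ℝ) • Δ) N (fun κ u κ' u' => bsum N (W κ u κ' u')) κ u κ' u' := by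
    funext κ u κ' u'
    rw [zero_smul, add_zero]
    rfl
  have hobj : legChain kc Kf N (l + 2) q (fun κ u κ' u' => bsumPow N q ((legStepB kc Kf N (l + 1) W - legStepB kc Kf N l W) κ u κ' u'))
      = (Q₀ + s • Q₁ + s ^ 2 • Q₂ + s ^ 3 • Q₃) - (Q₀ + (0 : ℝ) • Q₁ + (0 : ℝ) ^ 2 • Q₂ + (0 : ℝ) ^ 3 • Q₃) := by
    rw [legChain_bsumPow_sub hK (l + 2) q q hX hY, eX, eY, hline s, hline 0]
  -- Lagrange: the object is a combination of the four node windows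
  have hcomb : legChain kc Kf N (l + 2) q (fun κ u κ' u' => bsumPow N q ((legStepB kc Kf N (l + 1) W - legStepB kc Kf N l W) κ u κ' u'))
      = fun κ u κ' u' =>
        ((1 - s) * (2 - s) * (3 - s) / 6 - 1) • (Q₀ + (0 : ℝ) • Q₁ + (0 : ℝ) ^ 2 • Q₂ + (0 : ℝ) ^ 3 • Q₃) κ u κ' u'
        + (s * (2 - s) * (3 - s) / 2) • (Q₀ + (1 : ℝ) • Q₁ + (1 : ℝ) ^ 2 • Q₂ + (1 : ℝ) ^ 3 • Q₃) κ u κ' u'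
        + (-(s * (1 - s) * (3 - s) / 2)) • (Q₀ + (2 : ℝ) • Q₁ + (2 : ℝ) ^ 2 • Q₂ + (2 : ℝ) ^ 3 • Q₃) κ u κ' u'
        + (s * (1 - s) * (2 - s) / 6) • (Q₀ + (3 : ℝ) • Q₁ + (3 : ℝ) ^ 2 • Q₂ + (3 : ℝ) ^ 3 • Q₃) κ u κ' u' := by
    rw [hobj]
    funext κ u κ' u' x z a b
    simp only [Pi.add_apply, Pi.sub_apply, Pi.smul_apply, smul_eq_mul]
    exact lagrange_cubic_sub _ _ _ _ s
  -- the four node windows, by hypothesis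
  have hnode : ∀ j : ℕ, j ≤ 3 → BalabanCompositeJets.LocStencil₂ (Q₀ + (j : ℝ) • Q₁ + (j : ℝ) ^ 2 • Q₂ + (j : ℝ) ^ 3 • Q₃) c δ' := fun j hj => by
    rw [← hline (j : ℝ)]
    exact h j hj
  have h0 := hnode 0 (by norm_num)
  have h1 := hnode 1 (by norm_num)
  have h2 := hnode 2 (by norm_num)
  have h3 := hnode 3 (by norm_num)
  simp only [Nat.cast_zero, Nat.cast_one, Nat.cast_ofNat] at h0 h1 h2 h3
  have hsum := BalabanStepW2.locStencil₂_add' (BalabanStepW2.locStencil₂_add' (BalabanStepW2.locStencil₂_add'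
    (BalabanStepW2.locStencil₂_smul' ((1 - s) * (2 - s) * (3 - s) / 6 - 1) h0)
    (BalabanStepW2.locStencil₂_smul' (s * (2 - s) * (3 - s) / 2) h1))
    (BalabanStepW2.locStencil₂_smul' (-(s * (1 - s) * (3 - s) / 2)) h2))
    (BalabanStepW2.locStencil₂_smul' (s * (1 - s) * (2 - s) / 6) h3)
  rw [hcomb]
  refine locStencil₂_of_le hsum ?_
  have hw := lagrange_weights_le hs0 hs1
  calc |(1 - s) * (2 - s) * (3 - s) / 6 - 1| * c + |s * (2 - s) * (3 - s) / 2| * c + |(-(s * (1 - s) * (3 - s) / 2))| * c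
        + |s * (1 - s) * (2 - s) / 6| * c
      = (|(1 - s) * (2 - s) * (3 - s) / 6 - 1| + |s * (2 - s) * (3 - s) / 2| + |(-(s * (1 - s) * (3 - s) / 2))|
          + |s * (1 - s) * (2 - s) / 6|) * c := by ring
    _ ≤ (7 * s) * c := mul_le_mul_of_nonneg_right hw hc
    _ = 7 * s * c := by ring

/-- NOT IN PRINT; OUR BOOKKEEPING.  **THE DRIFT WINDOW `HΔw` FROM FOUR NATURAL WINDOWS OF THE RE-ROOTED FAMILIES** (`locStencil₂_stepDiff_of_interpolation` ⨾
`MixedStepLinearity.legChain_reroot_bottom`): every level of `K` decaying, `kc (l+1) = kc l`, `W` bounded, `Δ` decaying, `0 ≤ s ≤ 1`, `K (l+1) = K l + s • Δ`; IF for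
`j = 0,1,2,3` the natural `(q+1)`-window of the family `update K (l+1) (K l + j • Δ)` from level `l+1` obeys `LocStencil₂ · c δ′` THEN the `HΔw` object obeys
`LocStencil₂ · (7·s·c) δ′`.  The four windows have the H1-shape `legChain kc K′ N (l+1) (q+1) (bsumPow N (q+1) ∘ W)`; their composite legs are `kChain (krow ∘ K′) (l+1) q` and
`Push4Iter.legChain (colH ∘ K′) (l+1) q` with `K′ = update K (l+1) Mⱼ` — the objects of the OWNER's parts 8a ∕ 8b — and `Mⱼ = K l + j • Δ` decays with constant
`C + j·C_Δ ≤ C + 3·C_Δ`, uniformly in `l`. -/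
theorem locStencil₂_stepDiff_of_rerooted_windows (hK : ∀ n, ∃ δ C : ℝ, 0 < δ ∧ Decays (Kf n) C δ) {l : ℕ} (hkc : kc (l + 1) = kc l) (q : ℕ)
    {W : Tab d} (hW : ∃ B : ℝ, ∀ κ u κ' u' x z a b, |W κ u κ' u' x z a b| ≤ B)
    {Δ : MKer (d + 1) (Fib d)} {CΔ δΔ : ℝ} (hΔ : Decays Δ CΔ δΔ) (hδΔ : 0 < δΔ)
    {s : ℝ} (hs0 : 0 ≤ s) (hs1 : s ≤ 1) (hstep : Kf (l + 1) = Kf l + s • Δ) {c δ' : ℝ}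
    (h : ∀ j : ℕ, j ≤ 3 → BalabanCompositeJets.LocStencil₂
      (legChain kc (Function.update Kf (l + 1) (Kf l + (j : ℝ) • Δ)) N (l + 1) (q + 1) (fun κ u κ' u' => bsumPow N (q + 1) (W κ u κ' u'))) c δ') :
    BalabanCompositeJets.LocStencil₂
      (legChain kc Kf N (l + 2) q (fun κ u κ' u' => bsumPow N q ((legStepB kc Kf N (l + 1) W - legStepB kc Kf N l W) κ u κ' u')))
      (7 * s * c) δ' := by
  obtain ⟨δ₀, C₀, hδ₀, hK₀⟩ := hK l
  have hC₀ := nonneg_of_decays hK₀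
  have hCΔ := nonneg_of_decays hΔ
  refine locStencil₂_stepDiff_of_interpolation hK hkc q hW hΔ hδΔ hs0 hs1 hstep fun j hj => ?_
  have hMj : Decays (Kf l + (j : ℝ) • Δ) (C₀ + |(j : ℝ)| * CΔ) (min δ₀ δΔ) :=
    decays_add_min' hK₀ (decays_smul_of (j : ℝ) hΔ) hC₀ (mul_nonneg (abs_nonneg _) hCΔ)
  rw [← hkc, ← legChain_reroot_bottom hMj (lt_min hδ₀ hδΔ) l q hW]
  exact h j hj

/-- [folklore] **NORMALISING A SMALL STEP**: if `K₁ − K₀` decays with constant `ε ∈ [0, C_Δ]`, `C_Δ > 0`, then `K₁ = K₀ + s • Δ` with `s = ε ∕ C_Δ ∈ [0,1]` and `Δ`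
decaying with constant `C_Δ` (same rate) — `Δ := s⁻¹ • (K₁ − K₀)` (`Δ := 0` when `ε = 0`).  This is how the consumer feeds part 7's `Decays (K♮_{l+1} − K♮_l) (c_K·θ^l) δ`. -/
theorem exists_normalised_step {K₀ K₁ : MKer (d + 1) (Fib d)} {ε CΔ δ : ℝ} (hdiff : Decays (K₁ - K₀) ε δ) (hε : 0 ≤ ε) (hεC : ε ≤ CΔ) (hC : 0 < CΔ) :
    ∃ (s : ℝ) (Δ : MKer (d + 1) (Fib d)), 0 ≤ s ∧ s ≤ 1 ∧ s * CΔ = ε ∧ Decays Δ CΔ δ ∧ K₁ = K₀ + s • Δ := by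
  rcases eq_or_lt_of_le hε with hε0 | hεpos
  · refine ⟨0, 0, le_rfl, zero_le_one, by rw [← hε0, zero_mul], fun x y a b => ?_, ?_⟩
    · rw [Pi.zero_apply, Pi.zero_apply, Pi.zero_apply, Pi.zero_apply, abs_zero]; positivity
    · rw [zero_smul, add_zero]
      funext x y a b
      have h := hdiff x y a b
      rw [← hε0, zero_mul, Pi.sub_apply, Pi.sub_apply, Pi.sub_apply, Pi.sub_apply] at h
      have h0 : K₁ x y a b - K₀ x y a b = 0 := abs_eq_zero.1 (le_antisymm h (abs_nonneg _))
      exact sub_eq_zero.1 h0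
  · have hs : 0 < ε / CΔ := div_pos hεpos hC
    refine ⟨ε / CΔ, (ε / CΔ)⁻¹ • (K₁ - K₀), hs.le, (div_le_one hC).2 hεC, div_mul_cancel₀ ε hC.ne', fun x y a b => ?_, ?_⟩
    · have h := hdiff x y a b
      rw [Pi.smul_apply, Pi.smul_apply, Pi.smul_apply, Pi.smul_apply, smul_eq_mul, abs_mul, abs_of_pos (inv_pos.2 hs)]
      calc (ε / CΔ)⁻¹ * |(K₁ - K₀) x y a b| ≤ (ε / CΔ)⁻¹ * (ε * Real.exp (-δ * l1 (x - y))) :=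
            mul_le_mul_of_nonneg_left h (inv_pos.2 hs).le
        _ = CΔ * Real.exp (-δ * l1 (x - y)) := by rw [← mul_assoc, inv_div, div_mul_cancel₀ CΔ hεpos.ne']
    · rw [smul_smul, mul_inv_cancel₀ hs.ne', one_smul, add_sub_cancel]

/-- NOT IN PRINT; OUR BOOKKEEPING.  **THE DRIFT WINDOW `HΔw`, STEP-NORMALISATION INCLUDED** (the consumer-facing form of `locStencil₂_stepDiff_of_rerooted_windows`): every level of
`K` decaying, `kc (l+1) = kc l`, `W` bounded; the step `K (l+1) − K l` decaying with constant `ε ∈ [0, C_Δ]` at rate `δ_Δ > 0` (part 7: `ε = c_K·θ^l`); IF for EVERY `Δ` with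
`Decays Δ C_Δ δ_Δ` and every `j ≤ 3` the natural `(q+1)`-window of the family `update K (l+1) (K l + j • Δ)` from level `l+1` obeys `LocStencil₂ · c δ′` (the OWNER's generic-`M`
assemblies over 8a ∕ 8b, `M := K l + j • Δ` decaying with constant `C + j·C_Δ`), THEN the `HΔw` object obeys `LocStencil₂ · (7·(ε∕C_Δ)·c) δ′` — linear in `ε`, hence in `θ^l`. -/
theorem locStencil₂_stepDiff_of_decaying_step (hK : ∀ n, ∃ δ C : ℝ, 0 < δ ∧ Decays (Kf n) C δ) {l : ℕ} (hkc : kc (l + 1) = kc l) (q : ℕ)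
    {W : Tab d} (hW : ∃ B : ℝ, ∀ κ u κ' u' x z a b, |W κ u κ' u' x z a b| ≤ B)
    {ε CΔ δΔ : ℝ} (hdiff : Decays (Kf (l + 1) - Kf l) ε δΔ) (hε : 0 ≤ ε) (hεC : ε ≤ CΔ) (hCΔ : 0 < CΔ) (hδΔ : 0 < δΔ) {c δ' : ℝ}
    (h : ∀ Δ : MKer (d + 1) (Fib d), Decays Δ CΔ δΔ → ∀ j : ℕ, j ≤ 3 → BalabanCompositeJets.LocStencil₂
      (legChain kc (Function.update Kf (l + 1) (Kf l + (j : ℝ) • Δ)) N (l + 1) (q + 1) (fun κ u κ' u' => bsumPow N (q + 1) (W κ u κ' u'))) c δ') :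
    BalabanCompositeJets.LocStencil₂
      (legChain kc Kf N (l + 2) q (fun κ u κ' u' => bsumPow N q ((legStepB kc Kf N (l + 1) W - legStepB kc Kf N l W) κ u κ' u')))
      (7 * (ε / CΔ) * c) δ' := by
  obtain ⟨s, Δ, hs0, hs1, hsε, hΔ, hstep⟩ := exists_normalised_step hdiff hε hεC hCΔ
  have es : ε / CΔ = s := by rw [← hsε, mul_div_cancel_right₀ s hCΔ.ne']
  rw [es]
  exact locStencil₂_stepDiff_of_rerooted_windows hK hkc q hW hΔ hδΔ hs0 hs1 hstep (h Δ hΔ)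

end Main

end Summit.QuantumFields.BalabanUV.Beta.GAN24.StepDifferenceInterpolation

end
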